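import Summits.Ventures.Crystal3D.Theorems.StickyWulffConstantStackingLiminfOptimalCalibrationI
import HarnessLib

/-!
# The optimal calibration for the layer-profile ladder toward `StackingLiminf`
# (stmt-Ventures-19145), part II: monotonicity of the weight and of `G`, the exact value L5, constants
# (cf-p2 R20, `BLUEPRINT-profileDual.md` §3; planner's Lean companion landed by eng)

Route `StickyWulffConstant` of the venture `Summits/Ventures/Crystal3D` (cell `crystal3d-full`).
Over `StickyWulffConstantOptimalCalibrationDefs` (D1–D5): L1 `layer_identity`
(`ω_M n/√M ≤ d + Ψ₂(n)`); L2 `phiPos_mono`, the CAP `thetaW_cap` (`θ_w(m) ≤ 1 − δ/(c√m)`),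
`thetaW_le_one`, `thetaW_mono`, `thetaW_mul_le_Psi_sub`, `Psi2_le`, `G_mono` (with `G_zero`,
`thetaW_nonneg`, `omega_lt_sqrt`, `three_le_omega`, `three_le_s`, `s_sq`, `s_mono`); L5 exact form
`two_mul_G_top` (`2G(M) = 3M − (2/c)Σφ₊ − (c√M − δ)`); `omega_ge` (`ω_M ≥ β_c − κ_c/√M`) and the
constant identity `ceiling_identity` (`27β_c²B_c/4 = 243 + 54√3c + 45c²/4`).  Proofs: cf-p2 g10,
`HOME/cf-p2/OptimalCalibrationSketch.lean` (evidence #17 on stmt-Ventures-19145), verbatim.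
WHAT THIS IS NOT: the value ESTIMATE `B M − K√M ≤ 2G(M)` (separate file) nor the rung; F-C1 not moved.
-/

noncomputable section

namespace Summit.Ventures.Crystal3D.Theorems.OptimalCalibration

open Finset
/-- `θ_w ≤ 1` on `[0, M]` (from the cap). -/
theorem thetaW_le_one {c δ : ℝ} (hc : 0 < c) (hc2 : c ≤ 2) (hδ : 0 ≤ δ) (hδc : δ ≤ c) {M : ℕ}
    (hM : 31 ≤ M) {m : ℕ} (hmM : m ≤ M) : thetaW c δ M m ≤ 1 := by
  rcases Nat.eq_zero_or_pos m with rfl | hm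
  · simp [thetaW]
  · have h := thetaW_cap hc hc2 hδ hδc hM hm hmM
    have : 0 ≤ δ / (c * Real.sqrt m) := by positivity
    linarith

/-- `θ_w` is nondecreasing on `[0, M]` (L2(a) plus `θ_w(0) = 0 ≤ θ_w`). -/
theorem thetaW_mono {c δ : ℝ} (hc : 0 < c) (hc2 : c ≤ 2) (hδ : 0 ≤ δ) (hδc : δ ≤ c) {M : ℕ}
    (hM : 31 ≤ M) {a b : ℕ} (hab : a ≤ b) (hbM : b ≤ M) :
    thetaW c δ M a ≤ thetaW c δ M b := by
  rcases Nat.eq_zero_or_pos a with rfl | ha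
  · have h0 : thetaW c δ M 0 = 0 := by simp [thetaW]
    rw [h0]; exact thetaW_nonneg hc δ M b
  · -- induction on `b − a`
    obtain ⟨k, rfl⟩ := Nat.exists_eq_add_of_le hab
    induction k with
    | zero => simp
    | succ k ih =>
      have hkM : a + k ≤ M := by omega
      have h1 := ih (by omega) hkM
      have hak1 : 1 ≤ a + k := by omega
      have hstep : thetaW c δ M (a + k) ≤ thetaW c δ M (a + k + 1) := by
        have hφ := phiPos_mono hc hc2 hδ hδc hM hak1 (by omega)
        have hne : a + k ≠ 0 := by omega
        have hne' : a + k + 1 ≠ 0 := by omega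
        simp only [thetaW, hne, hne', if_false]
        exact div_le_div_of_nonneg_right hφ hc.le
      calc thetaW c δ M a ≤ thetaW c δ M (a + k) := h1
        _ ≤ thetaW c δ M (a + (k + 1)) := by rw [← add_assoc]; exact hstep

/-- L2(c): `θ_w(x)(y − x) ≤ Ψ(y) − Ψ(x)` for `x ≤ y ≤ M` (from L2(a); `θ_w(0) = 0`). -/
theorem thetaW_mul_le_Psi_sub {c δ : ℝ} (hc : 0 < c) (hc2 : c ≤ 2) (hδ : 0 ≤ δ) (hδc : δ ≤ c)
    {M : ℕ} (hM : 31 ≤ M) {x y : ℕ} (hxy : x ≤ y) (hyM : y ≤ M) :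
    thetaW c δ M x * ((y : ℝ) - x) ≤ Psi c δ M y - Psi c δ M x := by
  obtain ⟨k, rfl⟩ := Nat.exists_eq_add_of_le hxy
  induction k with
  | zero => simp
  | succ k ih =>
    have hkM : x + k ≤ M := by omega
    have h1 := ih (by omega) hkM
    have hstep : Psi c δ M (x + (k + 1)) = Psi c δ M (x + k) + thetaW c δ M (x + k + 1) := by
      rw [← add_assoc]; simp [Psi, Finset.sum_range_succ]
    have hmono : thetaW c δ M x ≤ thetaW c δ M (x + k + 1) :=
      thetaW_mono hc hc2 hδ hδc hM (by omega) (by omega)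
    rw [hstep]
    push_cast at h1 ⊢
    nlinarith

/-- `ω_M < √M` for `M ≥ 31`, `c ≤ 2`, `δ ≥ 0` (`ω_M ≤ 2 + √12 < 5.47 < √31`). -/
theorem omega_lt_sqrt {c δ : ℝ} (hc2 : c ≤ 2) (hδ : 0 ≤ δ) {M : ℕ} (hM : 31 ≤ M) :
    omega c δ M < Real.sqrt M := by
  have hM' : (31 : ℝ) ≤ M := by exact_mod_cast hM
  have hMpos : (0 : ℝ) < M := by linarith
  have hsM : Real.sqrt 31 ≤ Real.sqrt M := Real.sqrt_le_sqrt hM'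
  have h31 : (5.56 : ℝ) ≤ Real.sqrt 31 := by
    rw [show (5.56 : ℝ) = Real.sqrt (5.56 ^ 2) from (Real.sqrt_sq (by norm_num)).symm]
    exact Real.sqrt_le_sqrt (by norm_num)
  have h0 : (0 : ℝ) ≤ 3 / (M : ℝ) := by positivity
  have hlt : 12 - 3 / (M : ℝ) ≤ 3.47 ^ 2 := by
    norm_num
    linarith
  have h12 : s M ≤ 3.47 := by
    unfold s
    calc Real.sqrt (12 - 3 / (M : ℝ)) ≤ Real.sqrt (3.47 ^ 2) := Real.sqrt_le_sqrt hlt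
      _ = 3.47 := Real.sqrt_sq (by norm_num)
  have hδM : 0 ≤ δ / Real.sqrt M := by positivity
  unfold omega
  linarith

/-- One step of L2(e): `G(n) ≤ G(n+1)` for `n + 1 ≤ M`. -/
theorem G_step {c δ : ℝ} (hc : 0 < c) (hc2 : c ≤ 2) (hδ : 0 ≤ δ) (hδc : δ ≤ c) {M : ℕ}
    (hM : 31 ≤ M) {n : ℕ} (hnM : n + 1 ≤ M) :
    G c δ M n ≤ G c δ M (n + 1) := by
  have hM' : (31 : ℝ) ≤ M := by exact_mod_cast hM
  have hMpos : (0 : ℝ) < M := by linarith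
  have hsMpos : 0 < Real.sqrt M := Real.sqrt_pos.2 hMpos
  have hω := omega_lt_sqrt hc2 hδ hM (c := c)
  have hω1 : omega c δ M / Real.sqrt M < 1 := (div_lt_one hsMpos).2 hω
  have hθ1 : thetaW c δ M (n + 1) ≤ 1 := thetaW_le_one hc hc2 hδ hδc hM hnM
  have hPsi : Psi c δ M (n + 1) = Psi c δ M n + thetaW c δ M (n + 1) := by
    simp [Psi, Finset.sum_range_succ]
  -- the `Ψ₂` increment is at most `ω/√M` (for `n ≥ 1`) and equals `ω/√M − 3` for `n = 0`
  have hPsi2 : Psi2 c δ M (n + 1) - Psi2 c δ M n ≤ omega c δ M / Real.sqrt M + (if n = 0 then -3 else 0) := by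
    rcases Nat.eq_zero_or_pos n with rfl | hn
    · have h9 : Real.sqrt (12 * ((0 + 1 : ℕ) : ℝ) - 3) = 3 := by
        rw [show (12 * ((0 + 1 : ℕ) : ℝ) - 3) = 3 ^ 2 by push_cast; norm_num]
        exact Real.sqrt_sq (by norm_num)
      simp only [Psi2, Nat.add_one_ne_zero, if_false, if_true, h9]
      push_cast
      ring_nf
      linarith
    · have hn0 : n ≠ 0 := by omega
      simp only [Psi2, Nat.add_one_ne_zero, hn0, if_false]
      have hmono : Real.sqrt (12 * (n : ℝ) - 3) ≤ Real.sqrt (12 * ((n + 1 : ℕ) : ℝ) - 3) :=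
        Real.sqrt_le_sqrt (by push_cast; linarith)
      push_cast at hmono ⊢
      have e : omega c δ M * ((n : ℝ) + 1) / Real.sqrt M =
          omega c δ M * n / Real.sqrt M + omega c δ M / Real.sqrt M := by ring
      rw [e]
      linarith
  unfold G
  rw [hPsi]
  split_ifs at hPsi2 with h0
  · subst h0
    push_cast
    linarith
  · push_cast
    linarith

/-- L2(e): `G` is nondecreasing on `[0, M]` (`G(m+1) − G(m) ≥ 1/2 − ω_M/(2√M) > 0`). -/
theorem G_mono {c δ : ℝ} (hc : 0 < c) (hc2 : c ≤ 2) (hδ : 0 ≤ δ) (hδc : δ ≤ c) {M : ℕ}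
    (hM : 31 ≤ M) {x y : ℕ} (hxy : x ≤ y) (hyM : y ≤ M) :
    G c δ M x ≤ G c δ M y := by
  obtain ⟨k, rfl⟩ := Nat.exists_eq_add_of_le hxy
  induction k with
  | zero => simp
  | succ k ih =>
    have h1 := ih (by omega) (by omega)
    have h2 := G_step hc hc2 hδ hδc hM (n := x + k) (by omega)
    calc G c δ M x ≤ G c δ M (x + k) := h1
      _ ≤ G c δ M (x + (k + 1)) := by rw [← add_assoc]; exact h2

/-! ### L5 — the value of the dual -/

/-- L5 (exact form): `2·G(M) = 3M − (2/c)·Σ_{m=1}^{M} φ₊(m) − (c√M − δ)` (uses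
`Ψ₂(M) = √M·φ(M) = c√M − δ ≥ 0`). -/
theorem two_mul_G_top {c δ : ℝ} (hc : 0 < c) {M : ℕ} (hM : 31 ≤ M) :
    2 * G c δ M M = 3 * (M : ℝ) - 2 / c * ∑ m ∈ range M, max (phi c δ M (m + 1)) 0
      - (c * Real.sqrt M - δ) := by
  have hM' : (31 : ℝ) ≤ M := by exact_mod_cast hM
  have hMpos : (0 : ℝ) < M := by linarith
  have hM0 : M ≠ 0 := by omega
  have hsMpos : 0 < Real.sqrt M := Real.sqrt_pos.2 hMpos
  have hsMne : Real.sqrt M ≠ 0 := ne_of_gt hsMpos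
  have hc0 : c ≠ 0 := ne_of_gt hc
  -- `Ψ(M) = (1/c) Σ φ₊`
  have hPsi : Psi c δ M M = 1 / c * ∑ m ∈ range M, max (phi c δ M (m + 1)) 0 := by
    unfold Psi
    rw [Finset.mul_sum]
    refine Finset.sum_congr rfl fun m _ => ?_
    simp only [thetaW, Nat.add_one_ne_zero, if_false]
    ring
  -- `Ψ₂(M) = c√M − δ`
  have hPsi2 : Psi2 c δ M M = c * Real.sqrt M - δ := by
    simp only [Psi2, hM0, if_false]
    have h1 : Real.sqrt (12 * (M : ℝ) - 3) = Real.sqrt M * s M := by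
      unfold s
      rw [← Real.sqrt_mul hMpos.le]
      congr 1
      field_simp
    have h2 : (M : ℝ) / Real.sqrt M = Real.sqrt M := by
      rw [div_eq_iff hsMne]; exact (Real.mul_self_sqrt hMpos.le).symm
    rw [h1, mul_div_assoc, h2]
    have h3 : omega c δ M - s M = c - δ / Real.sqrt M := by unfold omega; ring
    calc omega c δ M * Real.sqrt M - Real.sqrt M * s M
        = Real.sqrt M * (omega c δ M - s M) := by ring
      _ = Real.sqrt M * (c - δ / Real.sqrt M) := by rw [h3]
      _ = c * Real.sqrt M - δ := by field_simp
  unfold G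
  rw [hPsi, hPsi2]
  field_simp


/-- `ω_M ≥ β_c − κ_c/√M` with `κ_c = δ + √3/(2√31)` (`s(M) ≥ 2√3 − √3/(2M)`, `M ≥ 31`). -/
theorem omega_ge {c δ : ℝ} (_hδ : 0 ≤ δ) {M : ℕ} (hM : 31 ≤ M) :
    2 * Real.sqrt 3 + c - (δ + Real.sqrt 3 / (2 * Real.sqrt 31)) / Real.sqrt M ≤ omega c δ M := by
  have hM' : (31 : ℝ) ≤ M := by exact_mod_cast hM
  have hMpos : (0 : ℝ) < M := by linarith
  have hsMpos : 0 < Real.sqrt M := Real.sqrt_pos.2 hMpos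
  have hsM : Real.sqrt 31 ≤ Real.sqrt M := Real.sqrt_le_sqrt hM'
  have hs31 : 0 < Real.sqrt 31 := Real.sqrt_pos.2 (by norm_num)
  have hMM : Real.sqrt M * Real.sqrt M = M := Real.mul_self_sqrt hMpos.le
  have h3 : Real.sqrt 3 ^ 2 = 3 := Real.sq_sqrt (by norm_num)
  have hs3 : 0 < Real.sqrt 3 := Real.sqrt_pos.2 (by norm_num)
  -- `s(M) ≥ 2√3 − √3/(2M)`
  have hsm : 2 * Real.sqrt 3 - Real.sqrt 3 / (2 * M) ≤ s M := by
    unfold s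
    have hx0 : 0 ≤ 2 * Real.sqrt 3 - Real.sqrt 3 / (2 * M) := by
      have : Real.sqrt 3 / (2 * M) ≤ Real.sqrt 3 / 1 :=
        div_le_div_of_nonneg_left hs3.le one_pos (by linarith)
      linarith
    have e : (2 * Real.sqrt 3 - Real.sqrt 3 / (2 * M)) ^ 2 =
        12 - 2 * (3 / M) + 3 / (4 * M ^ 2) := by
      linear_combination (4 - 2 / (M : ℝ) + 1 / (4 * (M : ℝ) ^ 2)) * h3
    have hle : (2 * Real.sqrt 3 - Real.sqrt 3 / (2 * M)) ^ 2 ≤ 12 - 3 / M := by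
      rw [e]
      have : 3 / (4 * (M : ℝ) ^ 2) ≤ 3 / M :=
        div_le_div_of_nonneg_left (by norm_num) hMpos (by nlinarith)
      linarith
    calc 2 * Real.sqrt 3 - Real.sqrt 3 / (2 * M)
        = Real.sqrt ((2 * Real.sqrt 3 - Real.sqrt 3 / (2 * M)) ^ 2) := (Real.sqrt_sq hx0).symm
      _ ≤ Real.sqrt (12 - 3 / M) := Real.sqrt_le_sqrt hle
  -- `√3/(2M) ≤ √3/(2√31·√M)`
  have hcmp : Real.sqrt 3 / (2 * M) ≤ Real.sqrt 3 / (2 * Real.sqrt 31 * Real.sqrt M) := by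
    apply div_le_div_of_nonneg_left hs3.le (by positivity)
    nlinarith [mul_le_mul_of_nonneg_right hsM hsMpos.le]
  have split : (δ + Real.sqrt 3 / (2 * Real.sqrt 31)) / Real.sqrt M =
      δ / Real.sqrt M + Real.sqrt 3 / (2 * Real.sqrt 31 * Real.sqrt M) := by
    rw [add_div, div_div]
  rw [split]
  unfold omega
  linarith

/-! ### The identity behind the constants (checked in exact arithmetic by r20a.py):
`27·β_c²·B_c/4 = 243 + 54√3·c + 45c²/4`; instances `c = 1`: `1017/4 + 54√3 = 347.78`,
`c = √2`: `531/2 + 54√6 = 397.77`. -/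

/-- The constant identity `27·β_c²·B_c/4 = 243 + 54√3·c + 45c²/4` (R20; `c = 1`: `347.78`,
`c = √2`: `397.77`). -/
theorem ceiling_identity {c : ℝ} (hc : 0 ≤ c) :
    27 * (2 * Real.sqrt 3 + c) ^ 2 *
        (1 + 2 / 3 * (36 + 6 * Real.sqrt 3 * c + c ^ 2) / (2 * Real.sqrt 3 + c) ^ 2) / 4 =
      243 + 54 * Real.sqrt 3 * c + 45 * c ^ 2 / 4 := by
  have h3 : Real.sqrt 3 ^ 2 = 3 := Real.sq_sqrt (by norm_num)
  have hs : 0 < Real.sqrt 3 := Real.sqrt_pos.2 (by norm_num)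
  have hβ : (2 * Real.sqrt 3 + c) ^ 2 ≠ 0 := by positivity
  have e : (2 * Real.sqrt 3 + c) ^ 2 *
      (1 + 2 / 3 * (36 + 6 * Real.sqrt 3 * c + c ^ 2) / (2 * Real.sqrt 3 + c) ^ 2) =
      (2 * Real.sqrt 3 + c) ^ 2 + 2 / 3 * (36 + 6 * Real.sqrt 3 * c + c ^ 2) := by
    rw [mul_add, mul_one, mul_div_assoc', mul_div_cancel_left₀ _ hβ]
  calc 27 * (2 * Real.sqrt 3 + c) ^ 2 *
        (1 + 2 / 3 * (36 + 6 * Real.sqrt 3 * c + c ^ 2) / (2 * Real.sqrt 3 + c) ^ 2) / 4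
        = 27 * ((2 * Real.sqrt 3 + c) ^ 2 *
          (1 + 2 / 3 * (36 + 6 * Real.sqrt 3 * c + c ^ 2) / (2 * Real.sqrt 3 + c) ^ 2)) / 4 := by
          ring
    _ = 27 * ((2 * Real.sqrt 3 + c) ^ 2 + 2 / 3 * (36 + 6 * Real.sqrt 3 * c + c ^ 2)) / 4 := by
          rw [e]
    _ = 243 + 54 * Real.sqrt 3 * c + 45 * c ^ 2 / 4 := by linear_combination (27 : ℝ) * h3

end Summit.Ventures.Crystal3D.Theorems.OptimalCalibration

end
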